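import Literature.Topology.FourManifolds.TautFoliationsSquareGrid
import HarnessLib

/-!
# Grid lines: interior points, open edges and vertices of a square grid

Topic: sequel to `TautFoliationsSquareGrid.lean`. Classification of the points of the big
square of a grid `g` off its boundary: a point both of whose coordinates avoid the grid lines
is in the OPEN small square of some index; a point on exactly one grid line is on an open
edge common to two edge-adjacent small squares; a point on two grid lines is a vertex.

* `Grid.OnLine₁ / OnLine₂` (**definitions**): the abscissa/ordinate is one of the grid values
  `a + 2kℓ`, `k ≤ n`; `Grid.vertices`, `Grid.centres` (**definitions**, finite);
* `exists_index_strict` (**proved**): strict one-dimensional indexing off the grid values;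
* `exists_mem_ball_centre` (**proved**): off both families of lines, the point is in an open
  small square;
* `exists_right_edge` / `exists_top_edge` (**proved**): on exactly one line (and in the open
  big square), the point is on the open right edge `x.1 = (centre q).1 + ℓ`,
  `|x.2 - (centre q).2| < ℓ` of a square `q` with `q.1 + 1 < n` (resp. the open top edge);
* `mem_vertices_of_onLine` (**proved**): on two lines, the point is a vertex.

All statements are [folklore].
-/

noncomputable section

open Set Metric

namespace Literature.Topology.FourManifolds

namespace SquareGrid

namespace Grid

variable (g : Grid) {x : ℝ × ℝ}

/-- The abscissa is a grid value. [folklore] -/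
def OnLine₁ (u : ℝ) : Prop := ∃ k : ℕ, k ≤ g.n ∧ u = g.a.1 + 2 * k * g.ℓ

/-- The ordinate is a grid value. [folklore] -/
def OnLine₂ (v : ℝ) : Prop := ∃ k : ℕ, k ≤ g.n ∧ v = g.a.2 + 2 * k * g.ℓ

/-- The vertices of the grid. [folklore] -/
def vertices : Set (ℝ × ℝ) :=
  (fun p : Fin (g.n + 1) × Fin (g.n + 1) ↦ (g.a.1 + 2 * (p.1 : ℕ) * g.ℓ, g.a.2 + 2 * (p.2 : ℕ) * g.ℓ)) '' univ

/-- The centres of the small squares. [folklore] -/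
def centres : Set (ℝ × ℝ) := range g.centre

/-- The vertices form a finite set. [folklore] -/
theorem finite_vertices : g.vertices.Finite := (finite_univ (α := Fin (g.n + 1) × Fin (g.n + 1))).image _

/-- The centres form a finite set. [folklore] -/
theorem finite_centres : g.centres.Finite := finite_range g.centre

/-- **Strict one-dimensional indexing off the grid values.** [folklore] -/
theorem exists_index_strict {u : ℝ} (hu₀ : 0 ≤ u) (hun : u ≤ 2 * g.n * g.ℓ)
    (hnot : ∀ k : ℕ, k ≤ g.n → u ≠ 2 * k * g.ℓ) :
    ∃ i : Fin g.n, 2 * (i : ℕ) * g.ℓ < u ∧ u < (2 * (i : ℕ) + 2) * g.ℓ := by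
  obtain ⟨i, h1, h2⟩ := g.exists_index hu₀ hun
  refine ⟨i, lt_of_le_of_ne h1 (fun h ↦ hnot i i.2.le h.symm), lt_of_le_of_ne h2 fun h ↦ ?_⟩
  have := hnot (i + 1) (by have := i.2; omega)
  apply this
  rw [h]; push_cast; ring

/-- **Off both families of grid lines, a point of the big square is in an open small square.**
[folklore] -/
theorem exists_mem_ball_centre (hx : x ∈ g.S) (h₁ : ¬ g.OnLine₁ x.1) (h₂ : ¬ g.OnLine₂ x.2) :
    ∃ q, x ∈ ball (g.centre q) g.ℓ := by
  rw [mem_S_iff] at hx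
  have hℓ := g.hℓ
  obtain ⟨i, hi1, hi2⟩ := g.exists_index_strict (u := x.1 - g.a.1) (by linarith) (by linarith)
    (fun k hk h ↦ h₁ ⟨k, hk, by linarith⟩)
  obtain ⟨j, hj1, hj2⟩ := g.exists_index_strict (u := x.2 - g.a.2) (by linarith) (by linarith)
    (fun k hk h ↦ h₂ ⟨k, hk, by linarith⟩)
  refine ⟨(i, j), ?_⟩
  rw [mem_ball, Prod.dist_eq, Real.dist_eq, Real.dist_eq, centre_fst, centre_snd, max_lt_iff, abs_lt, abs_lt]
  simp only
  exact ⟨⟨by linarith, by linarith⟩, ⟨by linarith, by linarith⟩⟩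

/-- **On a vertical grid line only, inside the open big square: the point is on the open right
edge of a square `q` with a right neighbour.** [folklore] -/
theorem exists_right_edge (hx : x ∈ g.S) (h₁ : g.OnLine₁ x.1) (h₂ : ¬ g.OnLine₂ x.2)
    (hlo : g.a.1 < x.1) (hhi : x.1 < g.a.1 + 2 * g.n * g.ℓ) :
    ∃ q : Fin g.n × Fin g.n, (q.1 : ℕ) + 1 < g.n ∧ x.1 = (g.centre q).1 + g.ℓ ∧ |x.2 - (g.centre q).2| < g.ℓ := by
  rw [mem_S_iff] at hx
  have hℓ := g.hℓ
  obtain ⟨k, hkn, hk⟩ := h₁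
  -- `0 < k < n`
  have hk0 : 0 < k := by
    rcases Nat.eq_zero_or_pos k with h | h
    · rw [h] at hk; simp at hk; linarith
    · exact h
  have hkn' : k < g.n := by
    by_contra h
    push Not at h
    have : k = g.n := le_antisymm hkn h
    rw [this] at hk; linarith
  obtain ⟨j, hj1, hj2⟩ := g.exists_index_strict (u := x.2 - g.a.2) (by linarith) (by linarith)
    (fun k hk h ↦ h₂ ⟨k, hk, by linarith⟩)
  refine ⟨(⟨k - 1, by omega⟩, j), by simp only; omega, ?_, ?_⟩
  · rw [centre_fst]
    simp only
    rw [hk]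
    have : ((k - 1 : ℕ) : ℝ) = k - 1 := by rw [Nat.cast_sub hk0]; simp
    rw [this]; ring
  · rw [centre_snd, abs_lt]
    simp only
    exact ⟨by linarith, by linarith⟩

/-- **On a horizontal grid line only, inside the open big square: the point is on the open top
edge of a square `q` with a top neighbour.** [folklore] -/
theorem exists_top_edge (hx : x ∈ g.S) (h₁ : ¬ g.OnLine₁ x.1) (h₂ : g.OnLine₂ x.2)
    (hlo : g.a.2 < x.2) (hhi : x.2 < g.a.2 + 2 * g.n * g.ℓ) :
    ∃ q : Fin g.n × Fin g.n, (q.2 : ℕ) + 1 < g.n ∧ x.2 = (g.centre q).2 + g.ℓ ∧ |x.1 - (g.centre q).1| < g.ℓ := by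
  rw [mem_S_iff] at hx
  have hℓ := g.hℓ
  obtain ⟨k, hkn, hk⟩ := h₂
  have hk0 : 0 < k := by
    rcases Nat.eq_zero_or_pos k with h | h
    · rw [h] at hk; simp at hk; linarith
    · exact h
  have hkn' : k < g.n := by
    by_contra h
    push Not at h
    have : k = g.n := le_antisymm hkn h
    rw [this] at hk; linarith
  obtain ⟨i, hi1, hi2⟩ := g.exists_index_strict (u := x.1 - g.a.1) (by linarith) (by linarith)
    (fun k hk h ↦ h₁ ⟨k, hk, by linarith⟩)
  refine ⟨(i, ⟨k - 1, by omega⟩), by simp only; omega, ?_, ?_⟩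
  · rw [centre_snd]
    simp only
    rw [hk]
    have : ((k - 1 : ℕ) : ℝ) = k - 1 := by rw [Nat.cast_sub hk0]; simp
    rw [this]; ring
  · rw [centre_fst, abs_lt]
    simp only
    exact ⟨by linarith, by linarith⟩

/-- **On two grid lines: a vertex.** [folklore] -/
theorem mem_vertices_of_onLine (h₁ : g.OnLine₁ x.1) (h₂ : g.OnLine₂ x.2) : x ∈ g.vertices := by
  obtain ⟨k, hk, hx1⟩ := h₁
  obtain ⟨k', hk', hx2⟩ := h₂
  refine ⟨(⟨k, by omega⟩, ⟨k', by omega⟩), mem_univ _, ?_⟩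
  ext
  · exact hx1.symm
  · exact hx2.symm

/-- The open big square in coordinates. [folklore] -/
theorem mem_ball_bigCentre_iff : x ∈ ball g.bigCentre (g.n * g.ℓ) ↔
    g.a.1 < x.1 ∧ x.1 < g.a.1 + 2 * g.n * g.ℓ ∧ g.a.2 < x.2 ∧ x.2 < g.a.2 + 2 * g.n * g.ℓ := by
  rw [mem_ball, Prod.dist_eq, Real.dist_eq, Real.dist_eq, bigCentre, max_lt_iff, abs_lt, abs_lt]
  simp only
  constructor
  · rintro ⟨⟨h1, h2⟩, h3, h4⟩; exact ⟨by linarith, by linarith, by linarith, by linarith⟩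
  · rintro ⟨h1, h2, h3, h4⟩; exact ⟨⟨by linarith, by linarith⟩, by linarith, by linarith⟩

/-- **Classification of the points of the open big square**: in an open small square, on an
open right edge, on an open top edge, or a vertex. [folklore] -/
theorem mem_ball_or_edge_or_vertex (hx : x ∈ ball g.bigCentre (g.n * g.ℓ)) :
    (∃ q, x ∈ ball (g.centre q) g.ℓ) ∨
    (∃ q : Fin g.n × Fin g.n, (q.1 : ℕ) + 1 < g.n ∧ x.1 = (g.centre q).1 + g.ℓ ∧ |x.2 - (g.centre q).2| < g.ℓ) ∨
    (∃ q : Fin g.n × Fin g.n, (q.2 : ℕ) + 1 < g.n ∧ x.2 = (g.centre q).2 + g.ℓ ∧ |x.1 - (g.centre q).1| < g.ℓ) ∨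
    x ∈ g.vertices := by
  have hxS : x ∈ g.S := ball_subset_closedBall hx
  rw [mem_ball_bigCentre_iff] at hx
  by_cases h₁ : g.OnLine₁ x.1
  · by_cases h₂ : g.OnLine₂ x.2
    · exact Or.inr (Or.inr (Or.inr (g.mem_vertices_of_onLine h₁ h₂)))
    · exact Or.inr (Or.inl (g.exists_right_edge hxS h₁ h₂ hx.1 hx.2.1))
  · by_cases h₂ : g.OnLine₂ x.2
    · exact Or.inr (Or.inr (Or.inl (g.exists_top_edge hxS h₁ h₂ hx.2.2.1 hx.2.2.2)))
    · exact Or.inl (g.exists_mem_ball_centre hxS h₁ h₂)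

end Grid

end SquareGrid

end Literature.Topology.FourManifolds
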